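import Literature.MathematicalPhysics.QuantumLattice.GrassmannWeightedCumulantKernelBoundPrescribed
import Literature.MathematicalPhysics.QuantumLattice.GrassmannWeightedEffectiveActionGradedTruncationDB
import Literature.MathematicalPhysics.QuantumLattice.GrassmannEffectiveActionGradedTruncationPrescribedDB
import HarnessLib

/-!
# The GRADED truncated step with the leg constraint kept, PRESCRIBED output legs, decay-WEIGHTED

Topic `MathematicalPhysics/QuantumLattice`; the `IsTreeWeight wt`-weighted twin of `GrassmannEffectiveActionGradedTruncationPrescribedDB`
(Benfatto–Giuliani–Mastropietro 2006, (2.13)–(2.14), (2.77)–(2.80) with §3 (3.2)–(3.8) and the sectorised bookkeeping of §2.4, Lemma 2.6;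
Gawȩdzki–Kupiainen 1985, §3; Gentile–Mastropietro 2001, §4).  One output label is pinned, the output labels of the slots `j ∈ J` are
constrained to prescribed predicates `A j`, the others are summed against the weight `wt` of the output label set; the kernels of the
interaction enter through the two-parameter family `N(m', F)` of `wt`-WEIGHTED anchored `L¹` norms with `F` further legs constrained
(`N(m', 0)` the plain weighted anchored norm).  The graded terms are an AVERAGE over the landing profiles `φ : J → Fin n` of the
prescribed slots (weights `w_φ = ∏_{j∈J} 2δ_{φ j} / N_δ^{|J|}`, `Σ_φ w_φ = 1`), the orders `≥ N₀` the flat weighted tail: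

`Σ_{W : W_i = w, A_j(W_j)} wt(W) ‖kernel_m (effAction C V − e^{Δ_C} V)(W)‖ ≤
   Σ_{n=2}^{N₀−1} κ^{-m} κ^{-2(n−1)} α^{n−1} eⁿ · Σ_{δ : m + 2(n−1) ≤ Σ 2δ_a} Σ_φ w_φ ∏_a (e³κ)^{2δ_a} N(δ_a, |φ⁻¹ a|)
   + ρ^{-m} e‖V‖_h θ^{N₀−1}/(1−θ)`,   `‖V‖_h`, `θ` built from `N(·, 0)` as in the weighted G1.

* `sum_wt_norm_kernel_cumulantOf_le_graded_prescribed_of_gramBounded` — the weighted graded cumulant bound with prescribed legs;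
* **`sum_wt_norm_kernel_effAction_sub_gaussConv_le_graded_prescribed_of_gramBounded`** — the weighted graded truncated step with
  prescribed legs.

Everything is proved; no definition, no named fact.

## Sources

G. Benfatto, A. Giuliani, V. Mastropietro, Ann. Henri Poincaré 7 (2006) 809–898, (2.13)–(2.14), (2.77)–(2.80), §2.4 Lemma 2.6,
§3 (3.2)–(3.8) [`BenfattoGiulianiMastropietro2006`]; G. Gentile, V. Mastropietro, Phys. Rep. 352 (2001) 273–437, §4 [`GentileMastropietro2001`];
K. Gawȩdzki, A. Kupiainen, Comm. Math. Phys. 102 (1985) 1–30, §3 [`GawedzkiKupiainen1985`].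
-/

noncomputable section

namespace Literature.MathematicalPhysics.QuantumLattice

open GrassmannAlgebra Finset Literature.Probability.LatticeModels Literature.Probability.LatticeModels.BattleFederbush
open scoped InnerProductSpace Nat

universe u

variable {𝕜 : Type*} [RCLike 𝕜] {Γ : Type u} [Fintype Γ] [DecidableEq Γ] {n : ℕ} {wt : Finset Γ → ℝ} (C : Matrix Γ Γ 𝕜)

/-! ### The weighted graded cumulant bound with prescribed legs -/

/-- **The graded, decay-weighted `L¹–L^∞` bound for the kernels of `𝓔ᵀ_C(V; n)` with prescribed output legs**
(`sum_wt_norm_kernel_cumulantOf_le_prescribed_of_gramBounded` with `λ_δ = 1/(α(N_δ+n))` and the weight-free `prescribedBound_le_indicator_sum`):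
`Σ_{W : W_i = w, A_j(W_j)} wt(W) ‖kernel_r 𝓔ᵀ_C(V; n)(W)‖ ≤ n! · κ^{-r} κ^{-2(n−1)} α^{n−1} eⁿ ·
Σ_{δ : r + 2(n−1) ≤ Σ 2δ_a} Σ_{φ : J → Fin n} w_φ Π_a (e³κ)^{2δ_a} N(δ_a, |φ⁻¹ a|)` (`w_φ = ∏_{j∈J} 2δ_{φ j}/N_δ^{|J|}`, `Σ_φ w_φ = 1`).
[cite: BenfattoGiulianiMastropietro2006, (2.13)-(2.14), (2.77)-(2.80), §3 (3.2)-(3.8) and Lemma 2.6] -/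
theorem sum_wt_norm_kernel_cumulantOf_le_graded_prescribed_of_gramBounded (hwt : IsTreeWeight wt) {κ : ℝ} (hκ : 0 < κ)
    (hGB : IsGramBoundedR C κ) (degs : Finset ℕ) (K : (m' : ℕ) → (Fin (2 * m') → Γ) → 𝕜) {r : ℕ} (J : Finset (Fin r)) (A : Fin r → Γ → Bool)
    (N : ℕ → ℕ → ℝ) (hN0 : ∀ m' F, 0 ≤ N m' F)
    (hN : ∀ (m' : ℕ) (T : Finset (Fin r)), T ⊆ J → ∀ (ι : T → Fin (2 * m')), Function.Injective ι →
      ∀ (t : Fin (2 * m')), (∀ j, ι j ≠ t) → ∀ a : Γ,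
        ∑ Y ∈ univ.filter (fun Y : Fin (2 * m') → Γ => Y t = a),
          ‖K m' Y‖ * wt (univ.image Y) * ∏ j : T, (if A j (Y (ι j)) = true then (1 : ℝ) else 0) ≤ N m' T.card)
    {α : ℝ} (hα : 0 < α) (hrow : ∀ X, ∑ Y, ‖C X Y‖ * wt {X, Y} ≤ α) (hcol : ∀ Y, ∑ X, ‖C X Y‖ * wt {X, Y} ≤ α)
    (hn : 0 < n) (i : Fin r) (hi : i ∉ J) (w : Γ) :
    ∑ W ∈ univ.filter (fun W : Fin r → Γ => W i = w ∧ ∀ j ∈ J, A j (W j) = true), wt (univ.image W) *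
        ‖kernel 𝕜 ((cumulantOf (fun k => evenGaussConv 𝕜 C (vertexOf 𝕜 degs K ^ k)) n : evenPart 𝕜 Γ) : GrassmannAlgebra 𝕜 Γ) r W‖ ≤
      (n ! : ℝ) * (κ⁻¹ ^ r * κ⁻¹ ^ (2 * (n - 1)) * (α ^ (n - 1) * Real.exp n)) *
        ∑ δ ∈ (Fintype.piFinset fun _ : Fin n => degs) with r + 2 * (n - 1) ≤ ∑ a, 2 * δ a,
          ∑ pf : J → Fin n, ((∏ j, ((2 * δ (pf j) : ℕ) : ℝ)) / ((∑ a, 2 * δ a : ℕ) : ℝ) ^ J.card) *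
            ∏ a, (Real.exp 3 * κ) ^ (2 * δ a) * N (δ a) (univ.filter fun j : J => pf j = a).card := by
  have h := sum_wt_norm_kernel_cumulantOf_le_prescribed_of_gramBounded C hwt hκ.le hGB degs K J A N hN0 hN hα.le hrow hcol
    (fun δ => (α * ((∑ a, (2 * δ a : ℝ)) + n))⁻¹) (fun δ => by positivity) hn i hi w
  refine h.trans ?_
  set c : ℝ := κ⁻¹ ^ r * κ⁻¹ ^ (2 * (n - 1)) * (((n - 1)! : ℝ) * α ^ (n - 1) * Real.exp n) with hc
  set G : (Fin n → ℕ) → ℝ := fun δ => ∑ pf : J → Fin n, ((∏ j, ((2 * δ (pf j) : ℕ) : ℝ)) / ((∑ a, 2 * δ a : ℕ) : ℝ) ^ J.card) *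
    ∏ a, (Real.exp 3 * κ) ^ (2 * δ a) * N (δ a) (univ.filter fun j : J => pf j = a).card with hG
  rw [← sum_filter]
  calc (n : ℝ) * ∑ δ ∈ (Fintype.piFinset fun _ : Fin n => degs) with r + 2 * (n - 1) ≤ ∑ a, 2 * δ a,
          ((((r.factorial : ℝ))⁻¹ * ((∏ j ∈ univ.filter (fun j : Fin r => j ∉ J), ((∑ a, 2 * δ a) - (j : ℕ)) : ℕ) : ℝ)) *
              κ ^ ((∑ a, 2 * δ a) - (r + 2 * (n - 1))) *
              ∑ pf : J → Fin n, (∏ j, ((2 * δ (pf j) : ℕ) : ℝ)) * ∏ a, N (δ a) (univ.filter fun j : J => pf j = a).card) *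
            (((α * ((∑ a, (2 * δ a : ℝ)) + n))⁻¹)⁻¹ ^ (n - 1) *
              ∏ ℓ : Sym2 (Fin n), (1 + (α * ((∑ a, (2 * δ a : ℝ)) + n))⁻¹ * (α * (pairDeg (fun a => 2 * δ a) ℓ : ℝ))))
      ≤ (n : ℝ) * ∑ δ ∈ (Fintype.piFinset fun _ : Fin n => degs) with r + 2 * (n - 1) ≤ ∑ a, 2 * δ a, c * G δ :=
        mul_le_mul_of_nonneg_left (sum_le_sum fun δ hδ =>
          prescribedBound_le_indicator_sum hκ hα hn N hN0 r J δ (mem_filter.1 hδ).2) (Nat.cast_nonneg n)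
    _ = (n ! : ℝ) * (κ⁻¹ ^ r * κ⁻¹ ^ (2 * (n - 1)) * (α ^ (n - 1) * Real.exp n)) *
          ∑ δ ∈ (Fintype.piFinset fun _ : Fin n => degs) with r + 2 * (n - 1) ≤ ∑ a, 2 * δ a, G δ := by
        rw [← mul_sum, hc, ← Nat.mul_factorial_pred (Nat.pos_iff_ne_zero.1 hn), Nat.cast_mul]
        ring

/-! ### The weighted graded truncated step with prescribed legs -/

/-- **The non-linear part of the renormalisation-group map, GRADED, decay-WEIGHTED, with prescribed output legs** (Benfatto–Giuliani–
Mastropietro 2006, (2.13)–(2.14) with (2.77)–(2.80), §3 (3.2)–(3.8), Lemma 2.6 and (2.84)–(2.90); Gawȩdzki–Kupiainen 1985, §3): with `wt`-weighted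
`‖V‖_h = Σ_{m' ≤ |Γ|/2} (e²(κ+ρ))^{2m'} N(m', 0)` and `θ = eα‖V‖_h/κ² < 1`, for every `N₀ ≥ 2`, every degree `m ≥ 1`, one output
label pinned and the output labels of the slots `j ∈ J` constrained to `A j`,
`Σ_W wt(W) ‖kernel_m (effAction C V − e^{Δ_C} V)(W)‖ ≤
   Σ_{n=2}^{N₀−1} κ^{-m} κ^{-2(n−1)} α^{n−1} eⁿ · Σ_{δ ∈ [0,|Γ|/2]^n, m + 2(n−1) ≤ Σ 2δ_a} Σ_{φ : J → Fin n} w_φ Π_a (e³κ)^{2δ_a} N(δ_a, |φ⁻¹ a|)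
   + ρ^{-m} e‖V‖_h θ^{N₀−1}/(1−θ)` — the graded terms AVERAGED (`Σ_φ w_φ = 1`) over the landing profile of the prescribed slots,
the tail flat.
[cite: BenfattoGiulianiMastropietro2006, (2.13)-(2.14), (2.77)-(2.80), §3 (3.2)-(3.8) and Lemma 2.6] -/
theorem sum_wt_norm_kernel_effAction_sub_gaussConv_le_graded_prescribed_of_gramBounded (hwt : IsTreeWeight wt) {κ : ℝ} (hκ : 0 < κ)
    (hGB : IsGramBoundedR C κ) (V : GrassmannAlgebra 𝕜 Γ) (hV : V ∈ evenPart 𝕜 Γ) (hV0 : constPart 𝕜 V = 0) {m : ℕ} (J : Finset (Fin m)) (A : Fin m → Γ → Bool)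
    (N : ℕ → ℕ → ℝ) (hN0 : ∀ m' F, 0 ≤ N m' F)
    (hN : ∀ (m' : ℕ) (T : Finset (Fin m)), T ⊆ J → ∀ (ι : T → Fin (2 * m')), Function.Injective ι →
      ∀ (t : Fin (2 * m')), (∀ j, ι j ≠ t) → ∀ a : Γ,
        ∑ Y ∈ univ.filter (fun Y : Fin (2 * m') → Γ => Y t = a),
          ‖kernel 𝕜 V (2 * m') Y‖ * wt (univ.image Y) * ∏ j : T, (if A j (Y (ι j)) = true then (1 : ℝ) else 0) ≤ N m' T.card)
    {α : ℝ} (hα : 0 < α) (hrow : ∀ X, ∑ Y, ‖C X Y‖ * wt {X, Y} ≤ α) (hcol : ∀ Y, ∑ X, ‖C X Y‖ * wt {X, Y} ≤ α) {ρ : ℝ} (hρ : 0 < ρ)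
    (hθ : Real.exp 1 * α * normV Γ κ ρ (fun m' => N m' 0) / κ ^ 2 < 1) {N₀ : ℕ} (hN₀ : 2 ≤ N₀) (hm : 0 < m) (i : Fin m) (hi : i ∉ J)
    (w : Γ) :
    ∑ W ∈ univ.filter (fun W : Fin m → Γ => W i = w ∧ ∀ j ∈ J, A j (W j) = true), wt (univ.image W) *
        ‖kernel 𝕜 (effAction 𝕜 C V - gaussConv 𝕜 C V) m W‖ ≤
      ∑ n ∈ Ico 2 N₀, (κ⁻¹ ^ m * κ⁻¹ ^ (2 * (n - 1)) * (α ^ (n - 1) * Real.exp n)) *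
          ∑ δ ∈ (Fintype.piFinset fun _ : Fin n => range (Fintype.card Γ / 2 + 1)) with m + 2 * (n - 1) ≤ ∑ a, 2 * δ a,
            ∑ pf : J → Fin n, ((∏ j, ((2 * δ (pf j) : ℕ) : ℝ)) / ((∑ a, 2 * δ a : ℕ) : ℝ) ^ J.card) *
              ∏ a, (Real.exp 3 * κ) ^ (2 * δ a) * N (δ a) (univ.filter fun j : J => pf j = a).card +
        ρ⁻¹ ^ m * (Real.exp 1 * normV Γ κ ρ (fun m' => N m' 0)) *
          (Real.exp 1 * α * normV Γ κ ρ (fun m' => N m' 0) / κ ^ 2) ^ (N₀ - 1) /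
            (1 - Real.exp 1 * α * normV Γ κ ρ (fun m' => N m' 0) / κ ^ 2) := by
  -- notation (as in `sum_norm_kernel_effAction_sub_gaussConv_le_graded_of_gramBounded`)
  set X : evenPart 𝕜 Γ := ⟨-V, neg_mem hV⟩ with hX
  set degs : Finset ℕ := range (Fintype.card Γ / 2 + 1) with hdegs
  set K : (m' : ℕ) → (Fin (2 * m') → Γ) → 𝕜 := fun m' => kernel 𝕜 (-V) (2 * m') with hK
  set Wset := univ.filter (fun W : Fin m → Γ => W i = w ∧ ∀ j ∈ J, A j (W j) = true) with hWset
  have hXv : vertexOf 𝕜 degs K = X := Subtype.ext (coe_vertexOf_kernel_eq 𝕜 X)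
  have hKnorm : ∀ (m' : ℕ) (Y : Fin (2 * m') → Γ), ‖K m' Y‖ = ‖kernel 𝕜 V (2 * m') Y‖ := fun m' Y => by
    rw [hK]
    dsimp only
    rw [show -V = (-1 : 𝕜) • V from (neg_one_smul 𝕜 V).symm, kernel_smul, norm_mul, norm_neg, norm_one, one_mul]
  -- the constrained hypothesis for the kernels of `-V`, and the plain weighted anchored norms (`T = ∅`)
  have hN' : ∀ (m' : ℕ) (T : Finset (Fin m)), T ⊆ J → ∀ (ι : T → Fin (2 * m')), Function.Injective ι →
      ∀ (t : Fin (2 * m')), (∀ j, ι j ≠ t) → ∀ a : Γ,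
        ∑ Y ∈ univ.filter (fun Y : Fin (2 * m') → Γ => Y t = a),
          ‖K m' Y‖ * wt (univ.image Y) * ∏ j : T, (if A j (Y (ι j)) = true then (1 : ℝ) else 0) ≤ N m' T.card := by
    intro m' T hT ι hι t ht a
    simp only [hKnorm]
    exact hN m' T hT ι hι t ht a
  have hNplain : ∀ (m' : ℕ) (j : Fin (2 * m')) (w : Γ),
      ∑ Y ∈ univ.filter (fun Y : Fin (2 * m') → Γ => Y j = w), ‖kernel 𝕜 V (2 * m') Y‖ * wt (univ.image Y) ≤ N m' 0 := by
    intro m' j w'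
    have h := hN m' ∅ (empty_subset _) (fun j => (notMem_empty _ j.2).elim) (fun j => (notMem_empty _ j.2).elim) j
      (fun j => (notMem_empty _ j.2).elim) w'
    simpa using h
  set κs : ℕ → evenPart 𝕜 Γ := fun n => cumulantOf (fun k => evenGaussConv 𝕜 C (X ^ k)) n with hκs
  have hκs_eq : ∀ n, κs n = cumulantOf (fun k => evenGaussConv 𝕜 C (vertexOf 𝕜 degs K ^ k)) n := fun n => by rw [hXv]
  -- the flat tail at order `N₀` (the constrained sum is part of the free one)
  obtain ⟨-, hbd⟩ := sum_wt_norm_kernel_effAction_add_sum_cumulant_le_of_gramBounded C hwt hκ hGB V hV hV0 (fun m' => N m' 0)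
    (fun m' => hN0 m' 0) hNplain hα hrow hcol hρ hθ (n₀ := N₀) (by omega)
  have htail : ∑ W ∈ Wset, wt (univ.image W) *
      ‖kernel 𝕜 (effAction 𝕜 C V) m W + ∑ n ∈ Ico 1 N₀, ((n ! : 𝕜))⁻¹ *
        kernel 𝕜 ((κs n : evenPart 𝕜 Γ) : GrassmannAlgebra 𝕜 Γ) m W‖ ≤
      ρ⁻¹ ^ m * (Real.exp 1 * normV Γ κ ρ (fun m' => N m' 0)) *
        (Real.exp 1 * α * normV Γ κ ρ (fun m' => N m' 0) / κ ^ 2) ^ (N₀ - 1) /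
          (1 - Real.exp 1 * α * normV Γ κ ρ (fun m' => N m' 0) / κ ^ 2) := by
    refine le_trans (sum_le_sum_of_subset_of_nonneg (fun W hW => ?_) fun _ _ _ => mul_nonneg (hwt.nonneg _) (norm_nonneg _))
      (hbd hm i w)
    rw [mem_filter] at hW ⊢
    exact ⟨hW.1, hW.2.1⟩
  -- the graded bound of one cumulant term, with the `1/n!`
  set G : ℕ → ℝ := fun n => (κ⁻¹ ^ m * κ⁻¹ ^ (2 * (n - 1)) * (α ^ (n - 1) * Real.exp n)) *
      ∑ δ ∈ (Fintype.piFinset fun _ : Fin n => degs) with m + 2 * (n - 1) ≤ ∑ a, 2 * δ a,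
        ∑ pf : J → Fin n, ((∏ j, ((2 * δ (pf j) : ℕ) : ℝ)) / ((∑ a, 2 * δ a : ℕ) : ℝ) ^ J.card) *
          ∏ a, (Real.exp 3 * κ) ^ (2 * δ a) * N (δ a) (univ.filter fun j : J => pf j = a).card with hG
  have hterm : ∀ n, 0 < n → ∑ W ∈ Wset,
      wt (univ.image W) * ‖((n ! : 𝕜))⁻¹ * kernel 𝕜 ((κs n : evenPart 𝕜 Γ) : GrassmannAlgebra 𝕜 Γ) m W‖ ≤ G n := by
    intro n hn
    have h := sum_wt_norm_kernel_cumulantOf_le_graded_prescribed_of_gramBounded C hwt hκ hGB degs K J A N hN0 hN' hα hrow hcol hn i hi w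
    rw [← hκs_eq] at h
    have hfac : (0 : ℝ) < n ! := by positivity
    calc ∑ W ∈ Wset, wt (univ.image W) * ‖((n ! : 𝕜))⁻¹ * kernel 𝕜 ((κs n : evenPart 𝕜 Γ) : GrassmannAlgebra 𝕜 Γ) m W‖
        = (n ! : ℝ)⁻¹ * ∑ W ∈ Wset, wt (univ.image W) * ‖kernel 𝕜 ((κs n : evenPart 𝕜 Γ) : GrassmannAlgebra 𝕜 Γ) m W‖ := by
          rw [mul_sum]
          exact sum_congr rfl fun W _ => by rw [norm_mul, norm_inv, RCLike.norm_natCast]; ring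
      _ ≤ (n ! : ℝ)⁻¹ * ((n ! : ℝ) * (κ⁻¹ ^ m * κ⁻¹ ^ (2 * (n - 1)) * (α ^ (n - 1) * Real.exp n)) *
            ∑ δ ∈ (Fintype.piFinset fun _ : Fin n => degs) with m + 2 * (n - 1) ≤ ∑ a, 2 * δ a,
              ∑ pf : J → Fin n, ((∏ j, ((2 * δ (pf j) : ℕ) : ℝ)) / ((∑ a, 2 * δ a : ℕ) : ℝ) ^ J.card) *
                ∏ a, (Real.exp 3 * κ) ^ (2 * δ a) * N (δ a) (univ.filter fun j : J => pf j = a).card) :=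
          mul_le_mul_of_nonneg_left h (by positivity)
      _ = G n := by rw [← mul_assoc, ← mul_assoc, inv_mul_cancel₀ hfac.ne', one_mul]
  -- the algebra: `kernel (effAction - e^{Δ}V) = [kernel effAction + Σ_{1 ≤ n < N₀} (n!)⁻¹ kernel κ_n] - Σ_{2 ≤ n < N₀} (n!)⁻¹ kernel κ_n`
  have hone : ∀ W, ((1 ! : 𝕜))⁻¹ * kernel 𝕜 ((κs 1 : evenPart 𝕜 Γ) : GrassmannAlgebra 𝕜 Γ) m W = -kernel 𝕜 (gaussConv 𝕜 C V) m W := by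
    intro W
    rw [hκs]
    dsimp only
    rw [Nat.factorial_one, Nat.cast_one, inv_one, one_mul, cumulantOf_one]
    simp only [pow_one, coe_evenGaussConv, hX, map_neg]
    rw [show -gaussConv 𝕜 C V = (-1 : 𝕜) • gaussConv 𝕜 C V from (neg_one_smul 𝕜 _).symm, kernel_smul]
    ring
  have hsplit : ∀ W, kernel 𝕜 (effAction 𝕜 C V - gaussConv 𝕜 C V) m W =
      (kernel 𝕜 (effAction 𝕜 C V) m W + ∑ n ∈ Ico 1 N₀, ((n ! : 𝕜))⁻¹ * kernel 𝕜 ((κs n : evenPart 𝕜 Γ) : GrassmannAlgebra 𝕜 Γ) m W) -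
        ∑ n ∈ Ico 2 N₀, ((n ! : 𝕜))⁻¹ * kernel 𝕜 ((κs n : evenPart 𝕜 Γ) : GrassmannAlgebra 𝕜 Γ) m W := by
    intro W
    rw [sum_eq_sum_Ico_succ_bot (by omega : 1 < N₀), show ((1 ! : 𝕜))⁻¹ * kernel 𝕜 ((κs 1 : evenPart 𝕜 Γ) : GrassmannAlgebra 𝕜 Γ) m W =
      -kernel 𝕜 (gaussConv 𝕜 C V) m W from hone W,
      show effAction 𝕜 C V - gaussConv 𝕜 C V = effAction 𝕜 C V + (-1 : 𝕜) • gaussConv 𝕜 C V by rw [neg_one_smul, sub_eq_add_neg],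
      kernel_add, kernel_smul]
    ring
  -- assemble
  calc ∑ W ∈ Wset, wt (univ.image W) * ‖kernel 𝕜 (effAction 𝕜 C V - gaussConv 𝕜 C V) m W‖
      ≤ ∑ W ∈ Wset,
          (wt (univ.image W) *
              ‖kernel 𝕜 (effAction 𝕜 C V) m W + ∑ n ∈ Ico 1 N₀, ((n ! : 𝕜))⁻¹ * kernel 𝕜 ((κs n : evenPart 𝕜 Γ) : GrassmannAlgebra 𝕜 Γ) m W‖ +
            ∑ n ∈ Ico 2 N₀, wt (univ.image W) * ‖((n ! : 𝕜))⁻¹ * kernel 𝕜 ((κs n : evenPart 𝕜 Γ) : GrassmannAlgebra 𝕜 Γ) m W‖) :=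
        sum_le_sum fun W _ => by
          rw [hsplit W, ← mul_sum, ← mul_add]
          exact mul_le_mul_of_nonneg_left ((norm_sub_le _ _).trans (add_le_add le_rfl (norm_sum_le _ _))) (hwt.nonneg _)
    _ = ∑ W ∈ Wset, wt (univ.image W) *
          ‖kernel 𝕜 (effAction 𝕜 C V) m W + ∑ n ∈ Ico 1 N₀, ((n ! : 𝕜))⁻¹ * kernel 𝕜 ((κs n : evenPart 𝕜 Γ) : GrassmannAlgebra 𝕜 Γ) m W‖ +
          ∑ n ∈ Ico 2 N₀, ∑ W ∈ Wset,
            wt (univ.image W) * ‖((n ! : 𝕜))⁻¹ * kernel 𝕜 ((κs n : evenPart 𝕜 Γ) : GrassmannAlgebra 𝕜 Γ) m W‖ := by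
        rw [sum_add_distrib, sum_comm]
    _ ≤ ρ⁻¹ ^ m * (Real.exp 1 * normV Γ κ ρ (fun m' => N m' 0)) *
          (Real.exp 1 * α * normV Γ κ ρ (fun m' => N m' 0) / κ ^ 2) ^ (N₀ - 1) /
            (1 - Real.exp 1 * α * normV Γ κ ρ (fun m' => N m' 0) / κ ^ 2) +
          ∑ n ∈ Ico 2 N₀, G n :=
        add_le_add htail (sum_le_sum fun n hn => hterm n (by have := (mem_Ico.1 hn).1; omega))
    _ = _ := by rw [hG, add_comm]

end Literature.MathematicalPhysics.QuantumLattice
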